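import Summits.CriticalPhenomena.PercolationContinuityZ3.Theorems.PercNearOneGluingNoHeavyLowerTailSahiOneStepTower
import HarnessLib

/-!
# THEOREM (one-step scheme): Kahn's Conjecture 5 / Sahi's `C₃` for a prescribed first slot `H` — the other two slots ARBITRARY —
# follows from TWO inequalities for pairs of test functions on the block that determines `H`

Support file (prover prim-ineq-prove-3 gen 14; `--supports stmt-CriticalPhenomena-4575`; memo
`run/shared/lean/prim/prim-ineq-prove-3/FINDING-G14-ONESTEP-THRESHOLD.md` §1–2, §4.3).  No definitions, no named facts, no sorries, no `native_decide`.

**THEOREM (`sahiE3_nonneg_of_oneStepPos`).**  Let `ι` be finite, `p : ι → [0,1]`, `F ⊆ ι` finite, `H ⊆ 2^ι` an event determined by `F`,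
and assume `OneStepPos p H F`: for all core test functions `φ, ψ` (increasing, `[0,1]`-valued, determined by `F`)
`0 ≤ m′(φ,ψ) = D(φψ) − d(φ,ψ)` and `0 ≤ n(φ,ψ) = d(φ,ψ) − S(φ,ψ)`, where `d(u,v) = E[1_H u]E[1_H v] + (1 − E1_H)E[1_H uv]` is the canonical
one-step certificate (`…SahiOneStepDefs`).  Then for ALL increasing events `A, B ⊆ 2^ι`: `0 ≤ E₃(H, A, B)` under `prodBernoulli p`
(functional form `osT_nonneg`: `0 ≤ E₃(1_H, f, g)` for all increasing `[0,1]`-valued `f, g`).  The event form of the hypotheses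
(`m′, n ≥ 0` on up-set indicators suffice) and their closed forms are in `…SahiOneStepCone`; the cylinder instance in `…SahiOneStepCylinder`.
`H` need not be increasing; no capacity condition and no recursion in `k` enter the hypotheses.

PROOF.  (i) TOWER (`osP_tower`): pivoting a free coordinate reproduces the antithetic tower functional `P_K` one level up, so by induction on
the number of coordinates on which `f, g` depend beyond `F ∪ K` (`osP_nonneg_aux`) positivity of all `P_K` reduces to the base case `f, g`
depending on `F ∪ K`; (ii) ONE-STEP IDENTITY: `P_K ≥ M_K` for ALL increasing `f, g` (`osM_le_osP`, induction on `K` via (†) `osP_insert_eq`,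
`osM_insert_eq` and `d(u,v) ≥ 0` on the nonnegative successive differences, `osCert_nonneg`); (iii) in the base case every section `f^x` is a
core test function (`sec_dep_core`), so `M_K ≥ 0` by `OneStepPos` (`osM_nonneg_of_oneStepPos`); (iv) `P_∅ = T` and `T(1_A,1_B) = sahiE3`
(`osT_ind_ind`).  Compared with gen 13's cdd certificate (an explicit all-`k` identity special to the OR event, `…SahiCddBase`), the one-step
scheme needs no recursion in its hypotheses.
-/

noncomputable section

namespace Summit.CriticalPhenomena.PercolationContinuityZ3.Theorems

namespace SahiOneStep

open Literature.Combinatorics.Sahi2008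
open Literature.Probability.Percolation (DeterminedBy determinedBy_iff)
open Literature.Probability.Percolation.DecisionTree (ind ind_of_mem ind_of_not_mem ind_nonneg)
open Literature.Probability.Percolation.BHK2006 (weight weight_nonneg blockFubini harris)
open Literature.Probability.LatticeModels (prodBernoulli sahiE3 sahiE3_def)
open SahiCdd (sec ex_congr' ex_lin2 ex_lin4 ex_split ex_mul_split sec_insert_of_not_mem sec_insert_insert
  sec_comp_insert sec_comp_sdiff sec_apply_insert sec_apply_sdiff monotone_sec dep_insert dep_sdiff ex_mul_le_ex_mul)

variable {ι : Type*} [Fintype ι] [DecidableEq ι]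

/-! ## The one-step base certificate: `M_K ≤ P_K` for all increasing `f, g` -/

omit [DecidableEq ι] in
/-- **The canonical certificate is nonnegative on nonnegative functions**: `d(u,v) = E[1_H u]E[1_H v] + (1 − E1_H)E[1_H uv] ≥ 0`
for `u, v ≥ 0`. [this work] -/
theorem osCert_nonneg (p : ι → unitInterval) (H : Set (Set ι)) {u v : Set ι → ℝ} (hu : ∀ ω, 0 ≤ u ω) (hv : ∀ ω, 0 ≤ v ω) :
    0 ≤ osCert p H u v := by
  have hμ0 : ∀ ω, 0 ≤ bernoulliWeight p ω := fun ω => weight_nonneg (fun i => (p i).2.1) (fun i => (p i).2.2) ω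
  unfold osCert
  have hle : ex (bernoulliWeight p) (ind H) ≤ 1 := by rw [ex_bernoulliWeight_ind]; exact MeasureTheory.measureReal_le_one
  refine add_nonneg (mul_nonneg ?_ ?_) (mul_nonneg (sub_nonneg.2 hle) ?_)
  · exact ex_nonneg hμ0 fun ω => mul_nonneg (ind_nonneg _ _) (hu ω)
  · exact ex_nonneg hμ0 fun ω => mul_nonneg (ind_nonneg _ _) (hv ω)
  · exact ex_nonneg hμ0 fun ω => mul_nonneg (mul_nonneg (ind_nonneg _ _) (hu ω)) (hv ω)

omit [DecidableEq ι] in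
/-- The per-pattern step of the one-step identity: `D(uv) − m′(u,v) = d(u,v) ≥ 0`. [this work] -/
theorem osMp_le_osD (p : ι → unitInterval) (H : Set (Set ι)) {u v : Set ι → ℝ} (hu : ∀ ω, 0 ≤ u ω) (hv : ∀ ω, 0 ≤ v ω) :
    osMp p H u v ≤ osD p H (fun ω => u ω * v ω) := by
  have h := osCert_nonneg p H hu hv
  have hdef : osD p H (fun ω => u ω * v ω) = osD p H (u * v) := rfl
  unfold osMp; rw [hdef]; linarith

/-- **`M_K ≤ P_K` for ALL increasing `f, g` and every first event `H`** (the one-step identity `P_K = M_K + R_K` with `R_K ≥ 0`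
dropped; induction on `K` via (†) and `osM_insert_eq`; only `d ≥ 0` on the nonnegative successive differences is used). [this work] -/
theorem osM_le_osP (p : ι → unitInterval) (H : Set (Set ι)) :
    ∀ (K : Finset ι) (f g : Set ι → ℝ), Monotone f → Monotone g → osM p H K f g ≤ osP p H K f g := by
  intro K
  induction K using Finset.induction_on with
  | empty =>
    intro f g _ _
    rw [osM_empty, osP_empty]
  | insert e K' heK' ih =>
    intro f g hfm hgm
    rw [osP_insert_eq p H heK' f g, osM_insert_eq p H heK' f g]
    have hf1m : Monotone (fun ω => f (insert e ω)) := fun _ _ hle => hfm (Set.insert_subset_insert hle)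
    have hf0m : Monotone (fun ω => f (ω \ {e})) := fun _ _ hle => hfm (Set.sdiff_subset_sdiff_left hle)
    have hg1m : Monotone (fun ω => g (insert e ω)) := fun _ _ hle => hgm (Set.insert_subset_insert hle)
    have hg0m : Monotone (fun ω => g (ω \ {e})) := fun _ _ hle => hgm (Set.sdiff_subset_sdiff_left hle)
    have h1 := ih _ _ hf1m hg0m
    have h2 := ih _ _ hf0m hg1m
    have h3 : ∑ x ∈ K'.powerset, osMp p H
          (fun ω => sec K' x (fun ω => f (insert e ω)) ω - sec K' x (fun ω => f (ω \ {e})) ω)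
          (fun ω => sec K' x (fun ω => g (insert e ω)) ω - sec K' x (fun ω => g (ω \ {e})) ω)
        ≤ ∑ x ∈ K'.powerset, osD p H (fun ω =>
          (sec K' x (fun ω => f (insert e ω)) ω - sec K' x (fun ω => f (ω \ {e})) ω) *
            (sec K' x (fun ω => g (insert e ω)) ω - sec K' x (fun ω => g (ω \ {e})) ω)) := by
      refine Finset.sum_le_sum fun x _ => ?_
      refine osMp_le_osD p H (fun ω => sub_nonneg.2 ?_) (fun ω => sub_nonneg.2 ?_)
      · exact hfm (Set.sdiff_subset.trans (Set.subset_insert _ _))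
      · exact hgm (Set.sdiff_subset.trans (Set.subset_insert _ _))
    linarith [h1, h2, h3]

/-! ## The main theorem -/

omit [Fintype ι] [DecidableEq ι] in
/-- In the base setting (`f` depends only on `F ∪ K`), a frozen section `sec K x f` depends only on `F`. [this work] -/
theorem sec_dep_core {F K x : Finset ι} {f : Set ι → ℝ}
    (hf : ∀ ω, f ω = f (ω ∩ ((F : Set ι) ∪ (K : Set ι)))) :
    ∀ ω, sec K x f ω = sec K x f (ω ∩ (F : Set ι)) := by
  intro ω
  simp only [sec]
  rw [hf (ω \ (K : Set ι) ∪ (x : Set ι)), hf ((ω ∩ (F : Set ι)) \ (K : Set ι) ∪ (x : Set ι))]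
  congr 1
  ext i
  simp only [Set.mem_inter_iff, Set.mem_union, Set.mem_sdiff, Finset.mem_coe]
  constructor
  · rintro ⟨⟨hiω, hiK⟩ | hix, hFK⟩
    · rcases hFK with hiF | hiK'
      · exact ⟨Or.inl ⟨⟨hiω, hiF⟩, hiK⟩, Or.inl hiF⟩
      · exact absurd hiK' hiK
    · exact ⟨Or.inr hix, hFK⟩
  · rintro ⟨⟨⟨hiω, -⟩, hiK⟩ | hix, hFK⟩
    · exact ⟨Or.inl ⟨hiω, hiK⟩, hFK⟩
    · exact ⟨Or.inr hix, hFK⟩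

/-- `M_K ≥ 0` in the base setting, from the one-step positivity hypothesis: every `m′(f^x,g^x)` and `n(f^x,g^{K∖x})` is a value of
`m′`, `n` on core test functions. [this work] -/
theorem osM_nonneg_of_oneStepPos (p : ι → unitInterval) {H : Set (Set ι)} {F : Finset ι} (hpos : OneStepPos p H F)
    (K : Finset ι) {f g : Set ι → ℝ}
    (hf : ∀ ω, f ω = f (ω ∩ ((F : Set ι) ∪ (K : Set ι)))) (hg : ∀ ω, g ω = g (ω ∩ ((F : Set ι) ∪ (K : Set ι))))
    (hfm : Monotone f) (hgm : Monotone g) (hf0 : ∀ ω, 0 ≤ f ω) (hf1 : ∀ ω, f ω ≤ 1) (hg0 : ∀ ω, 0 ≤ g ω) (hg1 : ∀ ω, g ω ≤ 1) :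
    0 ≤ osM p H K f g := by
  unfold osM
  refine Finset.sum_nonneg fun x _ => ?_
  have hcf : IsCoreFn F (sec K x f) :=
    ⟨monotone_sec hfm, fun ω => ⟨hf0 _, hf1 _⟩, sec_dep_core hf⟩
  have hcg : IsCoreFn F (sec K x g) :=
    ⟨monotone_sec hgm, fun ω => ⟨hg0 _, hg1 _⟩, sec_dep_core hg⟩
  have hcg' : IsCoreFn F (sec K (K \ x) g) :=
    ⟨monotone_sec hgm, fun ω => ⟨hg0 _, hg1 _⟩, sec_dep_core hg⟩
  exact add_nonneg (hpos _ _ hcf hcg).1 (hpos _ _ hcf hcg').2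

/-- **`P_K ≥ 0`** for increasing `[0,1]`-valued `f, g` depending on `F ∪ K ∪ G`, by induction on `|G|` (tower lemma; base `G = ∅`
by the one-step certificate). [this work] -/
theorem osP_nonneg_aux (p : ι → unitInterval) {H : Set (Set ι)} {F : Finset ι} (hH : DeterminedBy H (F : Set ι))
    (hpos : OneStepPos p H F) :
    ∀ (n : ℕ) (K G : Finset ι) (f g : Set ι → ℝ), G.card = n →
      (∀ ω, f ω = f (ω ∩ ((F : Set ι) ∪ (K : Set ι) ∪ (G : Set ι)))) →
      (∀ ω, g ω = g (ω ∩ ((F : Set ι) ∪ (K : Set ι) ∪ (G : Set ι)))) →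
      Monotone f → Monotone g → (∀ ω, 0 ≤ f ω) → (∀ ω, f ω ≤ 1) → (∀ ω, 0 ≤ g ω) → (∀ ω, g ω ≤ 1) →
      0 ≤ osP p H K f g := by
  intro n
  induction n with
  | zero =>
    intro K G f g hG hf hg hfm hgm hf0 hf1 hg0 hg1
    rw [Finset.card_eq_zero] at hG
    subst hG
    simp only [Finset.coe_empty, Set.union_empty] at hf hg
    exact (osM_nonneg_of_oneStepPos p hpos K hf hg hfm hgm hf0 hf1 hg0 hg1).trans (osM_le_osP p H K f g hfm hgm)
  | succ n ih =>
    intro K G f g hG hf hg hfm hgm hf0 hf1 hg0 hg1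
    obtain ⟨e, he⟩ : G.Nonempty := Finset.card_pos.1 (by omega)
    have hG' : (G.erase e).card = n := by rw [Finset.card_erase_of_mem he, hG]; rfl
    by_cases heFK : e ∈ F ∨ e ∈ K
    · have hset : (F : Set ι) ∪ (K : Set ι) ∪ (G : Set ι) = (F : Set ι) ∪ (K : Set ι) ∪ ((G.erase e : Finset ι) : Set ι) := by
        ext i
        simp only [Set.mem_union, Finset.mem_coe, Finset.mem_erase]
        constructor
        · rintro ((h | h) | h)
          · exact Or.inl (Or.inl h)
          · exact Or.inl (Or.inr h)
          · by_cases hie : i = e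
            · subst hie; exact Or.inl heFK
            · exact Or.inr ⟨hie, h⟩
        · rintro ((h | h) | ⟨-, h⟩)
          · exact Or.inl (Or.inl h)
          · exact Or.inl (Or.inr h)
          · exact Or.inr h
      rw [hset] at hf hg
      exact ih K (G.erase e) f g hG' hf hg hfm hgm hf0 hf1 hg0 hg1
    · simp only [not_or] at heFK
      obtain ⟨heF, heK⟩ := heFK
      rw [osP_tower p hH heF heK f g]
      have hS : ((F : Set ι) ∪ (K : Set ι) ∪ (G : Set ι)) \ {e} ⊆ (F : Set ι) ∪ (K : Set ι) ∪ ((G.erase e : Finset ι) : Set ι) := by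
        intro i hi
        simp only [Set.mem_sdiff, Set.mem_union, Finset.mem_coe, Set.mem_singleton_iff] at hi
        simp only [Set.mem_union, Finset.mem_coe, Finset.mem_erase]
        rcases hi with ⟨(h | h) | h, hne⟩
        · exact Or.inl (Or.inl h)
        · exact Or.inl (Or.inr h)
        · exact Or.inr ⟨hne, h⟩
      have hset2 : (F : Set ι) ∪ (K : Set ι) ∪ (G : Set ι) = (F : Set ι) ∪ ((insert e K : Finset ι) : Set ι) ∪ ((G.erase e : Finset ι) : Set ι) := by
        ext i
        simp only [Set.mem_union, Finset.mem_coe, Finset.mem_insert, Finset.mem_erase]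
        constructor
        · rintro ((h | h) | h)
          · exact Or.inl (Or.inl h)
          · exact Or.inl (Or.inr (Or.inr h))
          · by_cases hie : i = e
            · exact Or.inl (Or.inr (Or.inl hie))
            · exact Or.inr ⟨hie, h⟩
        · rintro ((h | h | h) | ⟨-, h⟩)
          · exact Or.inl (Or.inl h)
          · subst h; exact Or.inr he
          · exact Or.inl (Or.inr h)
          · exact Or.inr h
      have a1 := ih K (G.erase e) _ _ hG' (dep_insert hf hS) (dep_insert hg hS)
        (fun _ _ hle => hfm (Set.insert_subset_insert hle)) (fun _ _ hle => hgm (Set.insert_subset_insert hle))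
        (fun ω => hf0 _) (fun ω => hf1 _) (fun ω => hg0 _) (fun ω => hg1 _)
      have a0 := ih K (G.erase e) _ _ hG' (dep_sdiff hf hS) (dep_sdiff hg hS)
        (fun _ _ hle => hfm (Set.sdiff_subset_sdiff_left hle)) (fun _ _ hle => hgm (Set.sdiff_subset_sdiff_left hle))
        (fun ω => hf0 _) (fun ω => hf1 _) (fun ω => hg0 _) (fun ω => hg1 _)
      have a2 := ih (insert e K) (G.erase e) f g hG' (by rw [← hset2]; exact hf) (by rw [← hset2]; exact hg)
        hfm hgm hf0 hf1 hg0 hg1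
      have hp0 : 0 ≤ (p e : ℝ) := (p e).2.1
      have hq0 : 0 ≤ 1 - (p e : ℝ) := sub_nonneg.2 (p e).2.2
      have t1 : 0 ≤ (p e : ℝ) ^ 2 * osP p H K (fun ω => f (insert e ω)) (fun ω => g (insert e ω)) :=
        mul_nonneg (pow_nonneg hp0 2) a1
      have t2 : 0 ≤ (1 - (p e : ℝ)) ^ 2 * osP p H K (fun ω => f (ω \ {e})) (fun ω => g (ω \ {e})) :=
        mul_nonneg (pow_nonneg hq0 2) a0
      have t3 : 0 ≤ (p e : ℝ) * (1 - p e) * osP p H (insert e K) f g := mul_nonneg (mul_nonneg hp0 hq0) a2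
      linarith

omit [DecidableEq ι] in
/-- **THEOREM (one-step scheme, functional form).**  If `H` is determined by `F` and satisfies the one-step positivity hypothesis on
`F`, then `0 ≤ T(f,g) = E₃(1_H, f, g)` for ALL increasing `[0,1]`-valued `f, g` (depending on any coordinates). [this work] -/
theorem osT_nonneg (p : ι → unitInterval) {H : Set (Set ι)} {F : Finset ι} (hH : DeterminedBy H (F : Set ι))
    (hpos : OneStepPos p H F) {f g : Set ι → ℝ}
    (hfm : Monotone f) (hgm : Monotone g) (hf0 : ∀ ω, 0 ≤ f ω) (hf1 : ∀ ω, f ω ≤ 1) (hg0 : ∀ ω, 0 ≤ g ω) (hg1 : ∀ ω, g ω ≤ 1) :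
    0 ≤ osT p H f g := by
  classical
  rw [← osP_empty]
  refine osP_nonneg_aux p hH hpos (Finset.univ : Finset ι).card ∅ Finset.univ f g rfl ?_ ?_ hfm hgm hf0 hf1 hg0 hg1
  · intro ω; simp
  · intro ω; simp

omit [DecidableEq ι] in
/-- `T` on indicators is the tree's event functional `sahiE3 (prodBernoulli p) H`. [this work] -/
theorem osT_ind_ind (p : ι → unitInterval) (H A B : Set (Set ι)) :
    osT p H (ind A) (ind B) = sahiE3 (prodBernoulli p) H A B := by
  rw [← sahiE_three_ind, sahiE_three]
  unfold osT
  ring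

omit [DecidableEq ι] in
/-- **THEOREM (the one-step scheme for Kahn's Conjecture 5 / Sahi's `C₃` with a prescribed first slot).**  Let `H ⊆ 2^ι` be an event
determined by the finite block `F`, satisfying the one-step positivity hypothesis `OneStepPos p H F` (two inequalities for pairs of
core test functions on `F`).  Then for ALL increasing events `A, B ⊆ 2^ι`:  `0 ≤ E₃(H, A, B)` under `prodBernoulli p` — the other two
slots are unrestricted and the dimension is arbitrary. [this work] -/
theorem sahiE3_nonneg_of_oneStepPos (p : ι → unitInterval) {H : Set (Set ι)} {F : Finset ι}
    (hH : DeterminedBy H (F : Set ι)) (hpos : OneStepPos p H F) {A B : Set (Set ι)}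
    (hA : IsUpperSet A) (hB : IsUpperSet B) :
    0 ≤ sahiE3 (prodBernoulli p) H A B := by
  rw [← osT_ind_ind]
  exact osT_nonneg p hH hpos (monotone_ind_of_isUpperSet hA) (monotone_ind_of_isUpperSet hB)
    (fun ω => ind_nonneg _ _) (fun ω => Literature.Probability.Percolation.BHK2006.ind_le_one _ _)
    (fun ω => ind_nonneg _ _) (fun ω => Literature.Probability.Percolation.BHK2006.ind_le_one _ _)

end SahiOneStep

end Summit.CriticalPhenomena.PercolationContinuityZ3.Theorems
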